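import Literature.Computability.QuantumComplexity.MSubspaceSignReadoutMachine
import Literature.Computability.Complexity.SumcheckMAReferee
import Literature.Computability.Complexity.PlumbingBricks
import HarnessLib

/-!
# The M-subspace sign readout, II: the machine runs in polynomial time

Proof-only sequel of `MSubspaceSignReadoutMachine.lean`: every function of the readout machine
(`MMReadout.unitPts`, `d2`, `npiv`, `certOK`, `x0Of`, `kers`, `xOf`, `dotL`, `rbit`, `negCount`, `vote`,
`swapT`, `sideT`, `rowsAt`, `certAt`, `firstCert`, `answer`, `out`) is computed on codes by a polynomial-time
string function (`CodeFP`, assembled from the typed combinators of `CodeFP*.lean`, the circuit evaluator of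
`ForrelationCircuitCode.lean`, the row reduction of `F2RowReduction.lean` and the select-and-xor of
`QuadraticFourierSampler.lean`), uniformly in a finder `find ∈ FP`; whence the `FP` witness
**`exists_fp_out`**: a polynomial-time `dec` with `dec ⟨encode I, y⟩ = out find pF (instOf I) |encode I| y`.

## References

* S. Arora, B. Barak, *Computational Complexity: A Modern Approach*, CUP 2009, §1.3 (polynomial time:
  composition, bounded loops). [AroraBarak2009]
* O. Goldreich, *On promise problems*, 2006, Def. 1.2. [Goldreich2006]
-/

noncomputable section

namespace Literature.Computability.QuantumComplexity

namespace MMReadout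

open _root_.Computability Literature.Computability.Complexity Literature.Computability.Complexity.CodeFP
open Literature.Computability.Complexity.Brick (decNil)
open Literature.Computability.Complexity.F2Elim (bxorL Row rrun isPiv prow kvec pivRow bitsE stCE)
open ForrCode QuadSampler CubicDequant

/-! ### Small bricks -/

/-- A string as the raw list of its bits (blocks of length `1`). (Restated five-line brick, as
`SymExecCodeFP.bitsOfStr` / `PCPToCMMSAMachine.strBits`, which are not imported here to keep the import
closure small; librarian: hoist to `Complexity/CodeFPStrings.lean` next to `bitsToStr` and merge.) [folklore] -/
theorem bitsOfStr : CodeFP strE bitsE (fun w : List Bool => w) := by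
  have h : CodeFP strE (rawE strE) (fun w => (List.range w.length).map fun i => (w.drop (i * 1)).take 1) :=
    (strChunks.comp (strLength.pair ((const strE 1).pair (CodeFP.id strE)))).congr fun _ => rfl
  refine h.recodeOut fun w => ?_
  have hc : ((List.range w.length).map fun i => (w.drop (i * 1)).take 1) = w.map fun b => [b] := by
    refine List.ext_getElem (by simp) fun i h1 h2 => ?_
    rw [List.getElem_map, List.getElem_map, List.getElem_range, mul_one]
    have hi : i < w.length := by simpa using h2
    rw [List.drop_eq_getElem_cons hi, List.take_succ_cons, List.take_zero]
  rw [hc]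
  simp only [rawE, List.map_map]
  rfl

/-- A fixed polynomial of a unary numeral, in unary (`Plumb.polyFn`). (Duplicate of
`Regev2009.GIVPPost.polyEval_codeFP` / `HidingProgramMachine.unPoly_codeFP`: byte-identical two-line bricks in
unrelated developments, not imported here to keep the import closure small; librarian: hoist to
`Complexity/PlumbingBricks.lean` next to `Plumb.polyFn_mem_FP` and merge.) [folklore] -/
theorem unPoly (Q : Polynomial ℕ) : CodeFP unE unE (fun m => Q.eval m) :=
  ⟨Plumb.polyFn Q, Plumb.polyFn_mem_FP Q, fun m => by rw [Plumb.polyFn_apply, length_unE, unE_eq_ones]⟩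

/-- The pivot row as a total function (`prow`), on codes. [cite: AroraBarak2009, §1.3] -/
theorem prow_codeFP : CodeFP (pairE natE stCE) bitsE (fun q => prow q.2 q.1) := by
  have h := optCases (σ := ℕ × List Row) (eσ := pairE natE stCE) (eα := bitsE) (eδ := bitsE)
    (k := fun _ o => o.getD []) (gnone := fun _ => []) (gsome := fun t => t.2)
    (const _ []) (snd _ _) (fun _ => rfl) (fun _ _ => rfl)
  exact (h.comp ((CodeFP.id _).pair F2Elim.pivRow_codeFP)).congr fun _ => rfl

/-! ### The certificate -/

/-- The test points on codes. [cite: AroraBarak2009, §1.3] -/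
theorem unitPts_codeFP : CodeFP unE (rawE bitsE) unitPts := by
  have hm := CodeFP.map (σ := ℕ) (eσ := unE) (eα := natE) (eβ := bitsE) (g := fun t => unitL t.1 t.2) unitL_codeFP
  have hl : CodeFP unE (rawE bitsE) (fun n => (List.range n).map (unitL n)) :=
    (hm.comp ((CodeFP.id _).pair urange)).congr fun _ => rfl
  exact ((rawCons bitsE).comp (zeroL_codeFP.pair hl)).congr fun _ => rfl

/-- The code of the second-difference context `(c, (y, (r, s)))`. [folklore] -/
abbrev DE : PCirc × (List Bool × (List Bool × List Bool)) → List Bool := pairE pcE (pairE bitsE (pairE bitsE bitsE))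

/-- Second differences on codes. [cite: AroraBarak2009, §1.3] -/
theorem d2_codeFP : CodeFP DE bitE (fun t => d2 t.1 t.2.1 t.2.2.1 t.2.2.2) := by
  have hc : CodeFP DE pcE (fun t => t.1) := fst _ _
  have hy : CodeFP DE bitsE (fun t => t.2.1) := (snd _ _).fst'
  have hr : CodeFP DE bitsE (fun t => t.2.2.1) := (snd _ _).snd'.fst'
  have hs : CodeFP DE bitsE (fun t => t.2.2.2) := (snd _ _).snd'.snd'
  have hev : ∀ {v : PCirc × (List Bool × (List Bool × List Bool)) → List Bool}, CodeFP DE bitsE v →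
      CodeFP DE bitE (fun t => evalP t.1 (v t)) := fun hv => evalP_codeFP.comp (hc.pair (bitsToStr.comp hv))
  have h1 := hev hy
  have h2 := hev (F2Elim.bxorL_codeFP.comp (hy.pair hr))
  have h3 := hev (F2Elim.bxorL_codeFP.comp (hy.pair hs))
  have h4 := hev (F2Elim.bxorL_codeFP.comp (hy.pair (F2Elim.bxorL_codeFP.comp (hr.pair hs))))
  exact (((h1.xor h2).xor h3).xor h4).congr fun _ => rfl

/-- The rank on codes. [cite: AroraBarak2009, §1.3] -/
theorem npiv_codeFP : CodeFP (pairE unE stCE) natE (fun p => npiv p.1 p.2) := by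
  have hf := CodeFP.filter (σ := List Row) (eσ := stCE) (eα := natE) (p := fun t => isPiv t.1 t.2)
    (F2Elim.isPiv_codeFP.comp ((snd _ _).pair (fst _ _)))
  have h := (natLength natE).comp (hf.comp ((snd _ _).pair (urange.comp (fst unE stCE))))
  exact h.congr fun _ => rfl

/-- The code of the certificate context `(n, (c, L))`. [folklore] -/
abbrev CE : ℕ × (PCirc × List (List Bool)) → List Bool := pairE unE (pairE pcE (rawE bitsE))

/-- **The certificate check on codes.** [cite: AroraBarak2009, §1.3] -/
theorem certOK_codeFP : CodeFP CE bitE (fun t => certOK t.1 t.2.1 t.2.2) := by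
  have hn : CodeFP CE unE (fun t => t.1) := fst _ _
  have hc : CodeFP CE pcE (fun t => t.2.1) := (snd _ _).fst'
  have hL : CodeFP CE (rawE bitsE) (fun t => t.2.2) := (snd _ _).snd'
  have hS : CodeFP CE stCE (fun t => rrun t.1 t.2.2) := F2Elim.rrun_codeFP.comp (hn.pair hL)
  have hrank : CodeFP CE bitE (fun t => decide (2 * npiv t.1 (rrun t.1 t.2.2) = t.1)) :=
    natEq.comp ((natMul.comp ((const _ 2).pair (npiv_codeFP.comp (hn.pair hS)))).pair (natOfUn.comp hn))
  -- inner `all` over the test points, context `(t, rs)`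
  have hinner := CodeFP.all (σ := (ℕ × (PCirc × List (List Bool))) × (List Bool × List Bool))
    (eσ := pairE CE (pairE bitsE bitsE)) (eα := bitsE)
    (p := fun q => !d2 q.1.1.2.1 q.2 q.1.2.1 q.1.2.2)
    (d2_codeFP.comp ((fst _ _).fst'.snd'.fst'.pair ((snd _ _).pair ((fst _ _).snd'.fst'.pair (fst _ _).snd'.snd')))).not
  have hpts : CodeFP (pairE CE (pairE bitsE bitsE)) (rawE bitsE) (fun q => unitPts q.1.1) := unitPts_codeFP.comp (fst _ _).fst'
  have hin : CodeFP (pairE CE (pairE bitsE bitsE)) bitE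
      (fun q => (unitPts q.1.1).all fun y => !d2 q.1.2.1 y q.2.1 q.2.2) :=
    (hinner.comp ((CodeFP.id _).pair hpts)).congr fun _ => rfl
  have houter := CodeFP.all (σ := ℕ × (PCirc × List (List Bool))) (eσ := CE) (eα := pairE bitsE bitsE)
    (p := fun q => (unitPts q.1.1).all fun y => !d2 q.1.2.1 y q.2.1 q.2.2) hin
  have hprod : CodeFP CE (rawE (pairE bitsE bitsE)) (fun t => t.2.2.product t.2.2) := (rawProduct bitsE bitsE).comp (hL.pair hL)
  have hall := houter.comp ((CodeFP.id _).pair hprod)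
  exact (hrank.and hall).congr fun _ => rfl

/-! ### The sampler -/

/-- The code of the sampler context `((n, c), (S, z))`. [folklore] -/
abbrev XE : (ℕ × PCirc) × (List Row × List Bool) → List Bool := pairE (pairE unE pcE) (pairE stCE bitsE)

/-- The dual vector on codes. [cite: AroraBarak2009, §1.3] -/
theorem x0Of_codeFP : CodeFP XE bitsE (fun t => x0Of t.1.1 t.1.2 t.2.1 t.2.2) := by
  -- item map: context `t : XE`, item `j`
  have hc : CodeFP (pairE XE natE) pcE (fun q => q.1.1.2) := (fst _ _).fst'.snd'
  have hS : CodeFP (pairE XE natE) stCE (fun q => q.1.2.1) := (fst _ _).snd'.fst'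
  have hz : CodeFP (pairE XE natE) bitsE (fun q => q.1.2.2) := (fst _ _).snd'.snd'
  have hj : CodeFP (pairE XE natE) natE (fun q => q.2) := snd _ _
  have hp : CodeFP (pairE XE natE) bitsE (fun q => prow q.1.2.1 q.2) := prow_codeFP.comp (hj.pair hS)
  have h1 : CodeFP (pairE XE natE) bitE (fun q => evalP q.1.1.2 (bxorL q.1.2.2 (prow q.1.2.1 q.2))) :=
    evalP_codeFP.comp (hc.pair (bitsToStr.comp (F2Elim.bxorL_codeFP.comp (hz.pair hp))))
  have h2 : CodeFP (pairE XE natE) bitE (fun q => evalP q.1.1.2 q.1.2.2) := evalP_codeFP.comp (hc.pair (bitsToStr.comp hz))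
  have hg : CodeFP (pairE XE natE) bitE
      (fun q => isPiv q.1.2.1 q.2 && (evalP q.1.1.2 (bxorL q.1.2.2 (prow q.1.2.1 q.2)) ^^ evalP q.1.1.2 q.1.2.2)) :=
    (F2Elim.isPiv_codeFP.comp (hj.pair hS)).and (h1.xor h2)
  have hm := CodeFP.map (σ := (ℕ × PCirc) × (List Row × List Bool)) (eσ := XE) (eα := natE) (eβ := bitE)
    (g := fun q => isPiv q.1.2.1 q.2 && (evalP q.1.1.2 (bxorL q.1.2.2 (prow q.1.2.1 q.2)) ^^ evalP q.1.1.2 q.1.2.2)) hg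
  exact (hm.comp ((CodeFP.id _).pair (urange.comp (fst _ _).fst'))).congr fun _ => rfl

/-- The kernel rows on codes. [cite: AroraBarak2009, §1.3] -/
theorem kers_codeFP : CodeFP (pairE unE stCE) (rawE bitsE) (fun p => kers p.1 p.2) := by
  have hn : CodeFP (pairE (pairE unE stCE) natE) unE (fun q => q.1.1) := (fst _ _).fst'
  have hS : CodeFP (pairE (pairE unE stCE) natE) stCE (fun q => q.1.2) := (fst _ _).snd'
  have hf : CodeFP (pairE (pairE unE stCE) natE) natE (fun q => q.2) := snd _ _
  have hg : CodeFP (pairE (pairE unE stCE) natE) bitsE (fun q => if isPiv q.1.2 q.2 then [] else kvec q.1.1 q.1.2 q.2) :=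
    (F2Elim.isPiv_codeFP.comp (hf.pair hS)).ite (const _ []) (F2Elim.kvec_codeFP.comp ((hn.pair hf).pair hS))
  have hm := CodeFP.map (σ := ℕ × List Row) (eσ := pairE unE stCE) (eα := natE) (eβ := bitsE)
    (g := fun q => if isPiv q.1.2 q.2 then [] else kvec q.1.1 q.1.2 q.2) hg
  exact (hm.comp ((CodeFP.id _).pair (urange.comp (fst _ _)))).congr fun _ => rfl

/-- The code of the round context `((n, c), (S, (z, w)))`. [folklore] -/
abbrev RE' : (ℕ × PCirc) × (List Row × (List Bool × List Bool)) → List Bool :=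
  pairE (pairE unE pcE) (pairE stCE (pairE bitsE bitsE))

/-- The sampled partner on codes. [cite: AroraBarak2009, §1.3] -/
theorem xOf_codeFP : CodeFP RE' bitsE (fun t => xOf t.1.1 t.1.2 t.2.1 t.2.2.1 t.2.2.2) := by
  have hx0 : CodeFP RE' bitsE (fun t => x0Of t.1.1 t.1.2 t.2.1 t.2.2.1) := x0Of_codeFP.comp ((fst _ _).pair ((snd _ _).fst'.pair (snd _ _).snd'.fst'))
  have hk : CodeFP RE' (rawE bitsE) (fun t => kers t.1.1 t.2.1) := kers_codeFP.comp ((fst _ _).fst'.pair (snd _ _).fst')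
  have hsel : CodeFP RE' bitsE (fun t => xorSel t.1.1 (kers t.1.1 t.2.1) t.2.2.2) := xorSel_codeFP.comp ((fst _ _).fst'.pair (hk.pair (snd _ _).snd'.snd'))
  exact (F2Elim.bxorL_codeFP.comp (hx0.pair hsel)).congr fun _ => rfl

/-- The dot product on codes. [cite: AroraBarak2009, §1.3] -/
theorem dotL_codeFP : CodeFP (pairE unE (pairE bitsE bitsE)) bitE (fun t => dotL t.1 t.2.1 t.2.2) := by
  have hu : CodeFP (pairE (pairE unE (pairE bitsE bitsE)) natE) bitsE (fun q => q.1.2.1) := (fst _ _).snd'.fst'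
  have hv : CodeFP (pairE (pairE unE (pairE bitsE bitsE)) natE) bitsE (fun q => q.1.2.2) := (fst _ _).snd'.snd'
  have hi : CodeFP (pairE (pairE unE (pairE bitsE bitsE)) natE) natE (fun q => q.2) := snd _ _
  have hg : CodeFP (pairE (pairE unE (pairE bitsE bitsE)) natE) bitE (fun q => q.1.2.1.getD q.2 false && q.1.2.2.getD q.2 false) :=
    (F2Elim.getDBit_codeFP.comp (hu.pair hi)).and (F2Elim.getDBit_codeFP.comp (hv.pair hi))
  have hm := CodeFP.map (σ := ℕ × (List Bool × List Bool)) (eσ := pairE unE (pairE bitsE bitsE)) (eα := natE) (eβ := bitE)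
    (g := fun q => q.1.2.1.getD q.2 false && q.1.2.2.getD q.2 false) hg
  have hlist : CodeFP (pairE unE (pairE bitsE bitsE)) (rawE bitE)
      (fun t => (List.range t.1).map fun i => t.2.1.getD i false && t.2.2.getD i false) :=
    (hm.comp ((CodeFP.id _).pair (urange.comp (fst _ _)))).congr fun _ => rfl
  have hfold := foldl₀ (α := Bool) (β := Bool) (eα := bitE) (eβ := bitE) (step := fun a b => (b ^^ a)) (b₀ := false)
    (((snd bitE bitE).xor (fst bitE bitE)).congr fun _ => rfl) 1 (fun _ _ => by simp [bitE])
  exact (hfold.comp hlist).congr fun _ => rfl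

/-- The code of the full round context `((n, (cf, cg)), (S, (z, w)))`. [folklore] -/
abbrev BE : (ℕ × (PCirc × PCirc)) × (List Row × (List Bool × List Bool)) → List Bool :=
  pairE (pairE unE (pairE pcE pcE)) (pairE stCE (pairE bitsE bitsE))

/-- **One round on codes.** [cite: AroraBarak2009, §1.3] -/
theorem rbit_codeFP : CodeFP BE bitE (fun t => rbit t.1.1 t.1.2.1 t.1.2.2 t.2.1 t.2.2.1 t.2.2.2) := by
  have hn : CodeFP BE unE (fun t => t.1.1) := (fst _ _).fst'
  have hcf : CodeFP BE pcE (fun t => t.1.2.1) := (fst _ _).snd'.fst'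
  have hcg : CodeFP BE pcE (fun t => t.1.2.2) := (fst _ _).snd'.snd'
  have hz : CodeFP BE bitsE (fun t => t.2.2.1) := (snd _ _).snd'.fst'
  have hx : CodeFP BE bitsE (fun t => xOf t.1.1 t.1.2.2 t.2.1 t.2.2.1 t.2.2.2) := xOf_codeFP.comp ((hn.pair hcg).pair (snd _ _))
  have h1 : CodeFP BE bitE (fun t => evalP t.1.2.1 (xOf t.1.1 t.1.2.2 t.2.1 t.2.2.1 t.2.2.2)) := evalP_codeFP.comp (hcf.pair (bitsToStr.comp hx))
  have h2 : CodeFP BE bitE (fun t => evalP t.1.2.2 t.2.2.1) := evalP_codeFP.comp (hcg.pair (bitsToStr.comp hz))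
  have h3 : CodeFP BE bitE (fun t => dotL t.1.1 (xOf t.1.1 t.1.2.2 t.2.1 t.2.2.1 t.2.2.2) t.2.2.1) := dotL_codeFP.comp (hn.pair (hx.pair hz))
  exact ((h1.xor h2).xor h3).congr fun _ => rfl

/-- The code of the vote context `((n, (cf, cg)), (S, (y, a)))`. [folklore] -/
abbrev VE : (ℕ × (PCirc × PCirc)) × (List Row × (List Bool × ℕ)) → List Bool :=
  pairE (pairE unE (pairE pcE pcE)) (pairE stCE (pairE strE natE))

/-- The count of negative rounds on codes. [cite: AroraBarak2009, §1.3] -/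
theorem negCount_codeFP : CodeFP VE natE (fun t => negCount t.1.1 t.1.2.1 t.1.2.2 t.2.1 t.2.2.1 t.2.2.2) := by
  -- item map: context `t : VE`, item `r`
  have hctx : CodeFP (pairE VE natE) (pairE unE (pairE pcE pcE)) (fun q => q.1.1) := (fst _ _).fst'
  have hnU : CodeFP (pairE VE natE) unE (fun q => q.1.1.1) := (fst _ _).fst'.fst'
  have hn : CodeFP (pairE VE natE) natE (fun q => q.1.1.1) := natOfUn.comp hnU
  have hS : CodeFP (pairE VE natE) stCE (fun q => q.1.2.1) := (fst _ _).snd'.fst'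
  have hy : CodeFP (pairE VE natE) strE (fun q => q.1.2.2.1) := (fst _ _).snd'.snd'.fst'
  have ha : CodeFP (pairE VE natE) natE (fun q => q.1.2.2.2) := (fst _ _).snd'.snd'.snd'
  have hr : CodeFP (pairE VE natE) natE (fun q => q.2) := snd _ _
  have h2r : CodeFP (pairE VE natE) natE (fun q => 2 * q.2) := natMul.comp ((const _ 2).pair hr)
  have hoz : CodeFP (pairE VE natE) natE (fun q => q.1.2.2.2 + 2 * q.2 * q.1.1.1) :=
    natAdd.comp (ha.pair (natMul.comp (h2r.pair hn)))
  have how : CodeFP (pairE VE natE) natE (fun q => q.1.2.2.2 + (2 * q.2 + 1) * q.1.1.1) :=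
    natAdd.comp (ha.pair (natMul.comp ((natAdd.comp (h2r.pair (const _ 1))).pair hn)))
  have hz : CodeFP (pairE VE natE) bitsE (fun q => coinVec q.1.2.2.1 q.1.1.1 (q.1.2.2.2 + 2 * q.2 * q.1.1.1)) :=
    coinVec_codeFP.comp (hy.pair (hnU.pair hoz))
  have hw : CodeFP (pairE VE natE) bitsE (fun q => coinVec q.1.2.2.1 q.1.1.1 (q.1.2.2.2 + (2 * q.2 + 1) * q.1.1.1)) :=
    coinVec_codeFP.comp (hy.pair (hnU.pair how))
  have hb := rbit_codeFP.comp (hctx.pair (hS.pair (hz.pair hw)))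
  have hf := CodeFP.filter (σ := (ℕ × (PCirc × PCirc)) × (List Row × (List Bool × ℕ))) (eσ := VE) (eα := natE) hb
  have h := (natLength natE).comp (hf.comp ((CodeFP.id _).pair (const _ (List.range rounds))))
  exact h.congr fun _ => rfl

/-- **The vote on codes.** [cite: AroraBarak2009, §1.3] -/
theorem vote_codeFP : CodeFP VE bitE (fun t => vote t.1.1 t.1.2.1 t.1.2.2 t.2.1 t.2.2.1 t.2.2.2) :=
  (natLt.comp ((natMul.comp ((const _ 2).pair negCount_codeFP)).pair (const _ rounds))).congr fun _ => rfl

/-! ### The finder runs -/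

/-- The `i`-th circuit of an instance, on codes. [cite: AroraBarak2009, §1.3] -/
theorem circAtC (i : ℕ) : CodeFP instE pcE (fun t => circAt t i) :=
  circAt_codeFP.comp ((CodeFP.id _).pair (const _ i))

/-- The swapped instance on codes. [cite: AroraBarak2009, §1.3] -/
theorem swapT_codeFP : CodeFP instE instE swapT := by
  have h1 : CodeFP instE (rawE pcE) (fun t => [circAt t 0]) := (rawSingleton pcE).comp (circAtC 0)
  have h2 := (rawCons pcE).comp ((circAtC 1).pair h1)
  have h := instN_codeFP.pair (instK_codeFP.pair h2)
  exact h.congr fun _ => rfl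

/-- The instance of run `j` on codes. [cite: AroraBarak2009, §1.3] -/
theorem sideT_codeFP : CodeFP (pairE instE natE) instE (fun p => sideT p.1 p.2) := by
  have h := (natLt.comp ((snd instE natE).pair (const _ 3))).ite (fst _ _) (swapT_codeFP.comp (fst _ _))
  refine h.congr fun p => ?_
  by_cases hp : p.2 < 3 <;> simp [sideT, hp]

/-- The code of an instance, as a string. [folklore] -/
theorem instStr_codeFP : CodeFP instE strE (fun t => instE t) := transparent fun _ => rfl

variable {find : List Bool → List Bool} (hfind : find ∈ FP)
include hfind

/-- The finder on pairs of strings. [folklore] -/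
theorem find_codeFP : CodeFP (pairE strE strE) strE (fun p => find (boolPair p.1 p.2)) := of_fn find hfind fun _ => rfl

/-- The code of the run context `(t, (P, (y, j)))`. [folklore] -/
abbrev QE : Inst × (ℕ × (List Bool × ℕ)) → List Bool := pairE instE (pairE unE (pairE strE natE))

/-- **The rows of a finder run on codes** (the answer of `find` decoded as a list of bit rows).
[cite: AroraBarak2009, §1.3] -/
theorem rowsAt_codeFP : CodeFP QE (rawE bitsE) (fun t => rowsAt find t.1 t.2.1 t.2.2.1 t.2.2.2) := by
  have hPU : CodeFP QE unE (fun t => t.2.1) := (snd _ _).fst'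
  have hy : CodeFP QE strE (fun t => t.2.2.1) := (snd _ _).snd'.fst'
  have hj : CodeFP QE natE (fun t => t.2.2.2) := (snd _ _).snd'.snd'
  have hside := sideT_codeFP.comp ((fst instE (pairE unE (pairE strE natE))).pair hj)
  have hcode := instStr_codeFP.comp hside
  have hoff := natMul.comp (hj.pair (natOfUn.comp hPU))
  have hblk := bitsToStr.comp (coinVec_codeFP.comp (hy.pair (hPU.pair hoff)))
  have hs := (find_codeFP hfind).comp (hcode.pair hblk)
  have hrows : CodeFP (rawE strE) (rawE bitsE) (fun l : List (List Bool) => l) := (map₀ bitsOfStr).congr fun l => List.map_id' l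
  have h := hrows.comp (SumcheckMA.decNilC.comp hs)
  exact h.congr fun _ => rfl

/-- The code of the full run context `(t, (n, (P, (y, j))))`. [folklore] -/
abbrev QE' : Inst × (ℕ × (ℕ × (List Bool × ℕ))) → List Bool := pairE instE (pairE unE (pairE unE (pairE strE natE)))

/-- A run is certified, on codes. [cite: AroraBarak2009, §1.3] -/
theorem certAt_codeFP : CodeFP QE' bitE (fun t => certAt find t.1 t.2.1 t.2.2.1 t.2.2.2.1 t.2.2.2.2) := by
  have ht : CodeFP QE' instE (fun t => t.1) := fst _ _
  have hn : CodeFP QE' unE (fun t => t.2.1) := (snd _ _).fst'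
  have hrest : CodeFP QE' (pairE unE (pairE strE natE)) (fun t => t.2.2) := (snd _ _).snd'
  have hj : CodeFP QE' natE (fun t => t.2.2.2.2) := (snd _ _).snd'.snd'.snd'
  have hrows := (rowsAt_codeFP hfind).comp (ht.pair hrest)
  have hside := sideT_codeFP.comp (ht.pair hj)
  have hc := (circAtC 1).comp hside
  have h := certOK_codeFP.comp (hn.pair (hc.pair hrows))
  exact h.congr fun _ => rfl

/-- The code of the output context `(t, (n, (P, y)))`. [folklore] -/
abbrev OE : Inst × (ℕ × (ℕ × List Bool)) → List Bool := pairE instE (pairE unE (pairE unE strE))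

/-- The first certified run on codes. [cite: AroraBarak2009, §1.3] -/
theorem firstCert_codeFP : CodeFP OE (optE natE) (fun t => firstCert find t.1 t.2.1 t.2.2.1 t.2.2.2) := by
  have ht : CodeFP (pairE OE natE) instE (fun q => q.1.1) := (fst _ _).fst'
  have hn : CodeFP (pairE OE natE) unE (fun q => q.1.2.1) := (fst _ _).snd'.fst'
  have hP : CodeFP (pairE OE natE) unE (fun q => q.1.2.2.1) := (fst _ _).snd'.snd'.fst'
  have hy : CodeFP (pairE OE natE) strE (fun q => q.1.2.2.2) := (fst _ _).snd'.snd'.snd'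
  have hj : CodeFP (pairE OE natE) natE (fun q => q.2) := snd _ _
  have hp := (certAt_codeFP hfind).comp (ht.pair (hn.pair (hP.pair (hy.pair hj))))
  have hf := rawFind? (σ := Inst × (ℕ × (ℕ × List Bool))) (eσ := OE) (eα := natE) hp
  have h := hf.comp ((CodeFP.id _).pair (const _ (List.range 6)))
  exact h.congr fun _ => rfl

/-- The answer attached to an optional certified run, on codes. [cite: AroraBarak2009, §1.3] -/
theorem answer_codeFP : CodeFP (pairE OE (optE natE)) strE (fun t => answer find t.1.1 t.1.2.1 t.1.2.2.1 t.1.2.2.2 t.2) := by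
  -- the `some j` branch, context `(ctx, j)`
  have ht : CodeFP (pairE OE natE) instE (fun q => q.1.1) := (fst _ _).fst'
  have hnU : CodeFP (pairE OE natE) unE (fun q => q.1.2.1) := (fst _ _).snd'.fst'
  have hPU : CodeFP (pairE OE natE) unE (fun q => q.1.2.2.1) := (fst _ _).snd'.snd'.fst'
  have hy : CodeFP (pairE OE natE) strE (fun q => q.1.2.2.2) := (fst _ _).snd'.snd'.snd'
  have hj : CodeFP (pairE OE natE) natE (fun q => q.2) := snd _ _
  have hside := sideT_codeFP.comp (ht.pair hj)
  have hc0 := (circAtC 0).comp hside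
  have hc1 := (circAtC 1).comp hside
  have hrows := (rowsAt_codeFP hfind).comp (ht.pair (hPU.pair (hy.pair hj)))
  have hS := F2Elim.rrun_codeFP.comp (hnU.pair hrows)
  have ha := natMul.comp ((const (pairE OE natE) 6).pair (natOfUn.comp hPU))
  have hv := vote_codeFP.comp ((hnU.pair (hc0.pair hc1)).pair (hS.pair (hy.pair ha)))
  have hsome := bitStr_codeFP.comp hv
  have h := optCases (σ := Inst × (ℕ × (ℕ × List Bool))) (eσ := OE) (eα := natE) (eδ := strE)
    (k := fun s o => answer find s.1 s.2.1 s.2.2.1 s.2.2.2 o) (gnone := fun _ => []) (const _ []) hsome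
    (fun _ => rfl) (fun _ _ => rfl)
  exact h.congr fun _ => rfl

/-- **The output on codes**: `(instance code, coins) ↦ out find pF t |code| y`. [cite: AroraBarak2009, §1.3] -/
theorem out_codeFP (pF : Polynomial ℕ) : CodeFP (pairE instE strE) strE (fun p => out find pF p.1 (instE p.1).length p.2) := by
  have ht : CodeFP (pairE instE strE) instE (fun p => p.1) := fst _ _
  have hy : CodeFP (pairE instE strE) strE (fun p => p.2) := snd _ _
  have hL : CodeFP (pairE instE strE) unE (fun p => (instE p.1).length) := instLen_codeFP.comp ht
  have hL1 : CodeFP (pairE instE strE) unE (fun p => (instE p.1).length + 1) := unSucc.comp hL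
  have hn : CodeFP (pairE instE strE) natE (fun p => p.1.1) := instN_codeFP.comp ht
  have hk : CodeFP (pairE instE strE) bitE (fun p => decide (p.1.2.1 = 2)) := natEq.comp ((instK_codeFP.comp ht).pair (const _ 2))
  have hg : CodeFP (pairE instE strE) bitE (fun p => decide (p.1.1 ≤ (instE p.1).length + 1)) := natLeUn.comp (hn.pair hL1)
  have hne : CodeFP (pairE instE strE) unE (fun p => nEff p.1 (instE p.1).length) := (unOfNatMin.comp (hL1.pair hn)).congr fun _ => rfl
  have hP : CodeFP (pairE instE strE) unE (fun p => pF.eval (instE p.1).length) := (unPoly pF).comp hL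
  have hctx := ht.pair (hne.pair (hP.pair hy))
  have hans := (answer_codeFP hfind).comp (hctx.pair ((firstCert_codeFP hfind).comp hctx))
  have hall := (hk.and hg).ite hans (const _ [])
  refine hall.congr fun p => ?_
  dsimp only [out]

/-- **The output on genuine instance codes** is computed in polynomial time. [cite: AroraBarak2009, §1.3] -/
theorem outI_codeFP (pF : Polynomial ℕ) : CodeFP (pairE KForrelationInstance.encode strE) strE
    (fun p => out find pF (instOf p.1) p.1.encode.length p.2) := by
  have h := (out_codeFP hfind pF).comp ((instOf_codeFP.comp (fst KForrelationInstance.encode strE)).pair (snd _ _))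
  refine h.congr fun p => ?_
  dsimp only
  rw [encode_eq]

/-- **The `FP` witness of the readout machine**: a polynomial-time string function agreeing with `out`
on `⟨encode I, y⟩`. [cite: Goldreich2006, Def. 1.2] -/
theorem exists_fp_out (pF : Polynomial ℕ) : ∃ dec ∈ FP, ∀ (I : KForrelationInstance) (y : List Bool),
    dec (boolPair I.encode y) = out find pF (instOf I) I.encode.length y := by
  obtain ⟨F, hF, hFo⟩ := outI_codeFP hfind pF
  exact ⟨F, hF, fun I y => hFo (I, y)⟩

end MMReadout

end Literature.Computability.QuantumComplexity

end
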